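import Summits.AnomalousDissipation.AnomalousDissipation.Theorems.TwoAndHalfDTwohalfdThesisStubNoQuietWindow
import Summits.AnomalousDissipation.AnomalousDissipation.Theorems.TwoAndHalfDTwohalfdThesisStubWindowsToMean
import Literature.Analysis.FluidPDE.TimeAverageMeasureBasic
import Literature.Analysis.FluidPDE.LongTimeAverageNonneg
import Literature.Analysis.FluidPDE.AlexakisDoeringInterpolation

/-!
# R6 `stub_meanEnergyFloorOfLoss`: the mean-energy floor of a lossy family of releases

Stub R6 (wave 2) of the line `Sketch` (duhamel-release) for the crux
`Summit.AnomalousDissipation.AnomalousDissipation.Theses.TwoAndHalfD.TwohalfdThesis`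
(stmt-AnomalousDissipation-0206); the statement is registered verbatim on the item.

CONTENT. One drift `u` on `[0, ∞) × T²` with pointwise kinetic energy `∫‖u(t)‖² ≤ E` (`t ≥ 0`; only
to make the real `limsup` of the running means honest), classical releases `φ s` of the smooth
pattern `h` from every `s ≥ 0` (`∂ₜφ + u·∇φ = κΔφ` on `Ici s`, `φ s s = h`, `κ ≥ 0`), losing the
fraction `δ` of `‖h‖²` by age `τ₀ > 0` from every `s ≥ s₀ ≥ 0`. Put
`A := ‖h‖₂ (1 − √(1−δ)) − κ τ₀ ‖Δh‖₂` and `G := sup ‖∇h‖`. If `A ≥ 0` then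
`(A / (G τ₀))² ≤ ⟨∫‖u‖²⟩ := limsup_T T⁻¹ ∫₀ᵀ ∫‖u(t)‖² dt` (`longTimeAvgSup`).

PROOF. If `G = 0` the left-hand side is the junk value `(A/0)² = 0` and the claim is
`longTimeAvgSup_nonneg`. If `G > 0`: for every `s ≥ s₀`, restrict the release to `[s, s + τ₀]`
(`IsClassicalScalarTransportOn.restrict_Icc`) and apply R4 `stub_noQuietWindow`:
`A ≤ G ∫_s^{s+τ₀} ‖u(r)‖₂ dr = G ∫₀^{τ₀} ‖u(s+τ)‖₂ dτ`; Cauchy–Schwarz in time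
(`integral_le_sqrt_integral_mul_integral` against `1`) gives `A² ≤ G² τ₀ ∫₀^{τ₀} ‖u(s+τ)‖₂² dτ`,
i.e. every late window carries `ofReal (A²/(G²τ₀)) ≤ ∫⁻_{(0,τ₀)} ofReal ‖u(s+τ)‖₂²` (the energy
`t ↦ ‖u(t)‖₂²` is continuous on `Ici 0`, `u` being jointly smooth there by the release structure
at `s = 0`, so the real window integral is the lower Lebesgue integral,
`ofReal_integral_eq_lintegral_ofReal`). G2 `stub_windowsToMean` with `φ t := ofReal ‖u(t)‖₂²`
(a.e.-measurable and locally finite by continuity and the bound `E`; running means bounded by `E`,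
`isBoundedUnder_le_timeMean`) gives `A²/(G²τ₀)/τ₀ ≤ ⟨∫‖u‖²⟩`, and `(A/(Gτ₀))² = A²/(G²τ₀)/τ₀`.
Supports stmt-AnomalousDissipation-0206. [folklore: Doering–Foias 2002, §2; DEIJ 2022, §1]
-/

noncomputable section

-- the summit path `AnomalousDissipation/AnomalousDissipation` duplicates a namespace component
set_option linter.dupNamespace false

namespace Summit.AnomalousDissipation.AnomalousDissipation.Theorems.TwohalfdThesis

open MeasureTheory Set Filter Topology
open scoped ENNReal NNReal InnerProductSpace
open Literature.Analysis.FunctionSpaces Literature.Analysis.FluidPDE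

/-! ## Windows: shift, Cauchy–Schwarz in time, real-to-`ℝ≥0∞` -/

/-- Shift of an interval integral to the window `[0, c]`:
`∫₀ᶜ g(s + τ) dτ = ∫_s^{s+c} g(r) dr` (`intervalIntegral.integral_comp_add_left`). [folklore] -/
theorem meanEnergyFloor_intervalIntegral_shift (g : ℝ → ℝ) (s c : ℝ) :
    ∫ τ in (0 : ℝ)..c, g (s + τ) = ∫ r in s..(s + c), g r := by
  rw [intervalIntegral.integral_comp_add_left g s, add_zero]

/-- **Cauchy–Schwarz in time on a window.** For `f ≥ 0` continuous on `[0, c]`, `c ≥ 0`: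
`(∫₀ᶜ √f)² ≤ c ∫₀ᶜ f` (`integral_le_sqrt_integral_mul_integral` with `G = √f`, `E = f`, `L = 1`
on `(0, c]`). [folklore] -/
theorem meanEnergyFloor_sq_integral_sqrt_le {f : ℝ → ℝ} {c : ℝ} (hc : 0 ≤ c)
    (hf : ContinuousOn f (Icc 0 c)) (hf0 : ∀ τ, 0 ≤ f τ) :
    (∫ τ in (0 : ℝ)..c, Real.sqrt (f τ)) ^ 2 ≤ c * ∫ τ in (0 : ℝ)..c, f τ := by
  have hfi : IntegrableOn f (Ioc 0 c) := hf.integrableOn_Icc.mono_set Ioc_subset_Icc_self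
  rw [intervalIntegral.integral_of_le hc, intervalIntegral.integral_of_le hc]
  have hCS := integral_le_sqrt_integral_mul_integral (μ := volume.restrict (Ioc 0 c))
    (G := fun τ => Real.sqrt (f τ)) (E := f) (L := fun _ => (1 : ℝ))
    (ae_of_all _ fun τ => Real.sqrt_nonneg _) (ae_of_all _ fun τ => hf0 τ)
    (ae_of_all _ fun _ => zero_le_one)
    (ae_of_all _ fun τ => by rw [Real.sq_sqrt (hf0 τ), mul_one])
    (Real.continuous_sqrt.comp_aestronglyMeasurable hfi.aestronglyMeasurable)
    hfi (integrableOn_const measure_Ioc_lt_top.ne)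
  have h1 : ∫ _ in Ioc 0 c, (1 : ℝ) = c := by
    rw [setIntegral_const, Real.volume_real_Ioc_of_le hc, sub_zero, smul_eq_mul, mul_one]
  rw [h1] at hCS
  have hJ0 : 0 ≤ ∫ τ in Ioc 0 c, f τ := integral_nonneg fun τ => hf0 τ
  have hI0 : 0 ≤ ∫ τ in Ioc 0 c, Real.sqrt (f τ) := integral_nonneg fun τ => Real.sqrt_nonneg _
  calc (∫ τ in Ioc 0 c, Real.sqrt (f τ)) ^ 2
      ≤ (Real.sqrt ((∫ τ in Ioc 0 c, f τ) * c)) ^ 2 := pow_le_pow_left₀ hI0 hCS 2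
    _ = c * ∫ τ in Ioc 0 c, f τ := by rw [Real.sq_sqrt (mul_nonneg hJ0 hc), mul_comm]

/-- For `f ≥ 0` continuous on `[0, c]`, `c ≥ 0`, the lower Lebesgue integral of `ofReal f` over
`(0, c)` is `ofReal` of the real integral `∫₀ᶜ f` (`ofReal_integral_eq_lintegral_ofReal`; the
endpoint is Lebesgue-null). [folklore] -/
theorem meanEnergyFloor_lintegral_Ioo_eq {f : ℝ → ℝ} {c : ℝ} (hc : 0 ≤ c)
    (hf : ContinuousOn f (Icc 0 c)) (hf0 : ∀ τ, 0 ≤ f τ) :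
    ∫⁻ τ in Ioo 0 c, ENNReal.ofReal (f τ) = ENNReal.ofReal (∫ τ in (0 : ℝ)..c, f τ) := by
  have hfi : IntegrableOn f (Ioc 0 c) := hf.integrableOn_Icc.mono_set Ioc_subset_Icc_self
  rw [intervalIntegral.integral_of_le hc, setLIntegral_congr Ioo_ae_eq_Ioc,
    ofReal_integral_eq_lintegral_ofReal hfi (ae_of_all _ fun τ => hf0 τ)]

/-- **From kinetic action to kinetic energy on a window.** If `0 ≤ A ≤ G ∫₀ᶜ √f` with `G, c > 0`
and `f ≥ 0` continuous on `[0, c]`, then the window carries `ofReal (A²/(G²c)) ≤ ∫⁻_{(0,c)} ofReal f`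
(Cauchy–Schwarz in time, `meanEnergyFloor_sq_integral_sqrt_le`). [folklore] -/
theorem meanEnergyFloor_ofReal_le_lintegral {f : ℝ → ℝ} {A G c : ℝ} (hc : 0 < c) (hG : 0 < G)
    (hA : 0 ≤ A) (hf : ContinuousOn f (Icc 0 c)) (hf0 : ∀ τ, 0 ≤ f τ)
    (hAG : A ≤ G * ∫ τ in (0 : ℝ)..c, Real.sqrt (f τ)) :
    ENNReal.ofReal (A ^ 2 / (G ^ 2 * c)) ≤ ∫⁻ τ in Ioo 0 c, ENNReal.ofReal (f τ) := by
  have hCS := meanEnergyFloor_sq_integral_sqrt_le hc.le hf hf0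
  have hkey : A ^ 2 / (G ^ 2 * c) ≤ ∫ τ in (0 : ℝ)..c, f τ := by
    rw [div_le_iff₀ (by positivity)]
    calc A ^ 2 ≤ (G * ∫ τ in (0 : ℝ)..c, Real.sqrt (f τ)) ^ 2 := pow_le_pow_left₀ hA hAG 2
      _ = G ^ 2 * (∫ τ in (0 : ℝ)..c, Real.sqrt (f τ)) ^ 2 := mul_pow _ _ 2
      _ ≤ G ^ 2 * (c * ∫ τ in (0 : ℝ)..c, f τ) := mul_le_mul_of_nonneg_left hCS (sq_nonneg G)
      _ = (∫ τ in (0 : ℝ)..c, f τ) * (G ^ 2 * c) := by ring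
  rw [meanEnergyFloor_lintegral_Ioo_eq hc.le hf hf0]
  exact ENNReal.ofReal_le_ofReal hkey

/-! ## The stub: the mean-energy floor of a lossy family -/

/-- **R6 `stub_meanEnergyFloorOfLoss` (line `Sketch` = duhamel-release, crux
`TwoAndHalfD.TwohalfdThesis`): the mean-energy floor of a lossy family.** One drift `u` on
`[0,∞) × T²` with pointwise energy `∫‖u(t)‖² ≤ E` (`t ≥ 0`), classical releases `φ s` of the smooth
pattern `h` from every `s ≥ 0` (diffusivity `κ ≥ 0`), losing the fraction `δ` of `‖h‖²` by age
`τ₀ > 0` from every `s ≥ s₀ ≥ 0`; with `A := ‖h‖₂(1 − √(1−δ)) − κτ₀‖Δh‖₂ ≥ 0`: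
`(A / ((sup ‖∇h‖) τ₀))² ≤ ⟨∫‖u‖²⟩` (`longTimeAvgSup`). Proof: if `sup ‖∇h‖ = 0` the claim is
`longTimeAvgSup_nonneg`; otherwise R4 `stub_noQuietWindow` on `[s, s + τ₀]` and Cauchy–Schwarz in
time put `A²/((sup ‖∇h‖)² τ₀)` of kinetic energy on every late window
(`meanEnergyFloor_ofReal_le_lintegral`), and G2 `stub_windowsToMean` (the energy is continuous on
`Ici 0`, locally finite, with running means bounded by `E`) turns this into the floor
`A²/((sup ‖∇h‖)² τ₀²)` on the `limsup` mean. [folklore] -/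
theorem stub_meanEnergyFloorOfLoss :
    ∀ (κ E s₀ τ₀ δ : ℝ) (u : ℝ → (UnitAddTorus (Fin 2)) → (EuclideanSpace ℝ (Fin 2))) (h : (UnitAddTorus (Fin 2)) → ℝ)
      (φ : ℝ → ℝ → (UnitAddTorus (Fin 2)) → ℝ),
      0 ≤ κ → Torus.IsSmooth h → 0 < τ₀ → 0 ≤ s₀ →
      (∀ t, 0 ≤ t → ∫ x, ‖u t x‖ ^ 2 ≤ E) →
      (∀ s, 0 ≤ s → Torus.IsClassicalScalarTransportOn (Ici s) κ u (φ s) ∧ φ s s = h) →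
      (∀ s, s₀ ≤ s → Torus.scalarL2Sq (φ s (s + τ₀)) ≤ (1 - δ) * Torus.scalarL2Sq h) →
      0 ≤ Real.sqrt (Torus.scalarL2Sq h) * (1 - Real.sqrt (1 - δ)) -
          κ * τ₀ * Real.sqrt (Torus.scalarL2Sq (Torus.laplacian h)) →
      ((Real.sqrt (Torus.scalarL2Sq h) * (1 - Real.sqrt (1 - δ)) -
            κ * τ₀ * Real.sqrt (Torus.scalarL2Sq (Torus.laplacian h))) /
          ((⨆ x, ‖Torus.gradient h x‖) * τ₀)) ^ 2 ≤
        longTimeAvgSup (fun t => ∫ x, ‖u t x‖ ^ 2) := by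
  intro κ E s₀ τ₀ δ u h φ hκ hh hτ₀ hs₀ hE hφ hloss hA
  have he0 : ∀ t, 0 ≤ ∫ x, ‖u t x‖ ^ 2 := fun t => integral_nonneg fun x => sq_nonneg _
  have hG0 : 0 ≤ ⨆ x, ‖Torus.gradient h x‖ := Real.iSup_nonneg fun x => norm_nonneg _
  rcases eq_or_lt_of_le hG0 with hG | hGpos
  · -- degenerate pattern: the left-hand side is the junk value `(A / 0) ^ 2 = 0`
    rw [← hG, zero_mul, div_zero, zero_pow two_ne_zero]
    exact longTimeAvgSup_nonneg he0
  -- the kinetic energy is continuous on `Ici 0` (joint smoothness of `u` from the release at `0`)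
  have hcont : ContinuousOn (fun t => ∫ x, ‖u t x‖ ^ 2) (Ici 0) :=
    Torus.continuousOn_integral_norm_sq_of_continuousOn_stLift
      (hφ 0 le_rfl).1.smooth_velocity.continuousOn_stLift
  -- the side conditions of G2 for `φ t := ofReal (∫‖u t‖²)`
  have hmeas : AEMeasurable (fun t => ENNReal.ofReal (∫ x, ‖u t x‖ ^ 2))
      (volume.restrict (Ioi 0)) :=
    ((hcont.mono Ioi_subset_Ici_self).aemeasurable measurableSet_Ioi).ennreal_ofReal
  have hfin : ∀ T, 0 < T → ∫⁻ t in Ioo 0 T, ENNReal.ofReal (∫ x, ‖u t x‖ ^ 2) < ⊤ := by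
    intro T hT
    calc ∫⁻ t in Ioo 0 T, ENNReal.ofReal (∫ x, ‖u t x‖ ^ 2)
        ≤ ∫⁻ _ in Ioo 0 T, ENNReal.ofReal E :=
          setLIntegral_mono' measurableSet_Ioo fun t ht => ENNReal.ofReal_le_ofReal (hE t ht.1.le)
      _ = ENNReal.ofReal E * volume (Ioo 0 T) := setLIntegral_const _ _
      _ < ⊤ := ENNReal.mul_lt_top ENNReal.ofReal_lt_top measure_Ioo_lt_top
  have hbdd : IsBoundedUnder (· ≤ ·) atTop
      (timeMean fun t => (ENNReal.ofReal (∫ x, ‖u t x‖ ^ 2)).toReal) :=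
    isBoundedUnder_le_timeMean (C := E) fun t ht => by
      rw [ENNReal.toReal_ofReal (he0 t), abs_of_nonneg (he0 t)]
      exact hE t ht.le
  have htoReal : (fun t => (ENNReal.ofReal (∫ x, ‖u t x‖ ^ 2)).toReal) =
      fun t => ∫ x, ‖u t x‖ ^ 2 :=
    funext fun t => ENNReal.toReal_ofReal (he0 t)
  -- every late window carries `A² / (G² τ₀)` of kinetic energy (R4 and Cauchy–Schwarz in time)
  set A := Real.sqrt (Torus.scalarL2Sq h) * (1 - Real.sqrt (1 - δ)) -
      κ * τ₀ * Real.sqrt (Torus.scalarL2Sq (Torus.laplacian h)) with hA_def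
  set G := ⨆ x, ‖Torus.gradient h x‖ with hG_def
  have hwin : ∀ s, s₀ ≤ s → ENNReal.ofReal (A ^ 2 / (G ^ 2 * τ₀)) ≤
      ∫⁻ τ in Ioo 0 τ₀, ENNReal.ofReal (∫ x, ‖u (s + τ) x‖ ^ 2) := by
    intro s hs
    have hs0 : 0 ≤ s := hs₀.trans hs
    obtain ⟨hθ, hθs⟩ := hφ s hs0
    have hsb : s < s + τ₀ := by linarith
    have hθI : Torus.IsClassicalScalarTransportOn (Icc s (s + τ₀)) κ u (φ s) :=
      hθ.restrict_Icc hsb Icc_subset_Ici_self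
    have hR4 := stub_noQuietWindow κ s τ₀ δ u h (φ s) hκ hh hτ₀.le hθI hθs (hloss s hs)
    rw [← meanEnergyFloor_intervalIntegral_shift (fun r => Real.sqrt (∫ x, ‖u r x‖ ^ 2)) s τ₀,
      ← hG_def] at hR4
    have hAG : A ≤ G * ∫ τ in (0 : ℝ)..τ₀, Real.sqrt (∫ x, ‖u (s + τ) x‖ ^ 2) := by
      rw [hA_def]
      linarith
    have hfc : ContinuousOn (fun τ => ∫ x, ‖u (s + τ) x‖ ^ 2) (Icc 0 τ₀) := by
      refine hcont.comp (f := fun τ => s + τ) (by fun_prop) ?_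
      intro τ hτ
      exact mem_Ici.2 (add_nonneg hs0 hτ.1)
    exact meanEnergyFloor_ofReal_le_lintegral hτ₀ hGpos hA hfc (fun τ => he0 _) hAG
  -- G2: sliding windows to the `limsup` mean
  have hG2 := stub_windowsToMean (fun t => ENNReal.ofReal (∫ x, ‖u t x‖ ^ 2))
    (A ^ 2 / (G ^ 2 * τ₀)) τ₀ s₀ hmeas hfin (by positivity) hτ₀ hs₀ hwin hbdd
  calc (A / (G * τ₀)) ^ 2 = A ^ 2 / (G ^ 2 * τ₀) / τ₀ := by ring
    _ ≤ longTimeAvgSup (fun t => (ENNReal.ofReal (∫ x, ‖u t x‖ ^ 2)).toReal) := hG2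
    _ = longTimeAvgSup (fun t => ∫ x, ‖u t x‖ ^ 2) := by rw [htoReal]

end Summit.AnomalousDissipation.AnomalousDissipation.Theorems.TwohalfdThesis

end
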